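import Mathlib
import Literature.RingTheory.CohomologyAnnihilator.Basic
import Literature.RingTheory.CohomologyAnnihilator.StableAnnihilation
import Literature.RingTheory.CohomologyAnnihilator.TowerBasic
import Summits.ResolutionOfSingularities.ResolutionOfSingularities.Theorems.HomologicalConductorPersistenceTwoStepTransferExponentTwo
import Summits.ResolutionOfSingularities.ResolutionOfSingularities.Theorems.HomologicalConductorPersistenceExtFlatBaseChange
import HarnessLib

/-!
# The relative sequence `0 → A[X] ⊗_A M → A[X] ⊗_A M → M → 0` and exponent two (THEOREM A §1, Cor. 3.2)

Crux `HomologicalConductor.Persistence` (stmt-ResolutionOfSingularities-16484), chain W4.4b; pool object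
**W4.4b U1 = THEOREM A in Lean**, FILE 1b (res-L1-w44b-plan-1 UNCLAIMED-STUB LIST 08:48:32Z / CUT
08:51:41Z). Source: res-L1-w44b-stub-3, `L/res-L1-w44b-stub-3/THEOREM-A.md` c2177413955d684d
(refereed PASS, res-L1-w44b-tri-1 REFEREE-ThmA-C 33cf618fe8e641b4), §1 «the relative sequence and
the cone resolution» and Corollary (3.2) «exponent two». `[OURS · L1 w44b]` — folklore homological
algebra, NOT a statement of the manuscript under review in cell res-hironaka and using none of its
statements; AI-written, weaker than expert review.

Setting: `A` any commutative ring; `R` a commutative `A`-algebra which IS a polynomial ring in one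
variable `x : R` in the honest sense that the powers `xⁿ` form an `A`-basis (`b : Module.Basis ℕ A R`,
`hb : ∀ n, b n = x ^ n`; §3 specialises to `R = A[X] = Polynomial A`, `x = X`,
`b = Polynomial.basisMonomials A`); `M` any `R`-module (a type carrying compatible `A`- and
`R`-structures, `[IsScalarTower A R M]`; NO finiteness), `N` any `R`-module, `Ext` = Mathlib's
`CategoryTheory.Abelian.Ext` in `ModuleCat`. (Stating §1–§2 over an abstract `A[x]` keeps ONE
instance path for `R ⊗_A M`; the literal `A[X]` versions of §3 are one-line specialisations.)

* §1 `exists_relativeMaps`, `mu_comp_T`, `mu_surjective`, `exists_splitting`, `ker_T_eq_bot`,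
  `exact_T_mu`, **`relativeSequence_shortExact`** — THEOREM-A (1.1): the sequence
  `0 → R ⊗_A M —T→ R ⊗_A M —μ→ M → 0`, `T = x ⊗ 1 − 1 ⊗ x_M`, `μ (p ⊗ m) = p • m`, is short exact
  in `ModuleCat R`. The maps are taken as ANY `R`-linear `T`, `μ` with the displayed values on
  pure tensors (def-free; `exists_relativeMaps` provides them); exactness comes from the explicit
  `A`-linear splitting `G (xⁿ ⊗ m) = Σ_{j<n} xʲ ⊗ x^{n−1−j} m` («division by `x ⊗ 1 − 1 ⊗ x`»).
* §2 **exponent two** (THEOREM-A Cor. (3.2), hypotheses on the PAIR `(c, M|_A)`):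
  `mul_smul_ext_eq_zero_of_relativeSequence` (`A[X]`-currency: `c` kills `Ext^{m}(A[X] ⊗_A M, N)`,
  `d` kills `Ext^{m+1}(A[X] ⊗_A M, N)` ⇒ `c·d` kills `Ext^{m+1}_{A[X]}(M, N)` — the long exact sequence
  of §1, tree `mul_smul_ext_X₃_eq_zero_of_shortExact`);
  **`sq_smul_ext_eq_zero_of_restrictScalars`** (`A`-currency: `c : A` kills `Extᵐ_A(M|_A, N|_A)` and
  `Ext^{m+1}_A(M|_A, N|_A)` ⇒ `(algebraMap c)²` kills `Ext^{m+1}_{A[X]}(M, N)` — via the flat base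
  change `Extⁱ_A(M|_A, N|_A) ≅ Extⁱ_{A[X]}(A[X] ⊗_A M, N)` of the sibling file
  `…PersistenceExtFlatBaseChange`); `sq_smul_ext_eq_zero_of_forall_ge` (THEOREM-A's «(Hₙ)» read in
  `Ext`-currency: `c` kills `Ext^{≥ n}_A(M|_A, −)` ⇒ `(algebraMap c)²` kills `Ext^{≥ n+1}_{A[X]}(M, −)`);
  `sq_smul_ext_eq_zero_of_comp_eq_smul_id` (THEOREM-A's (H₁) literally: `c • 𝟙_{M|_A}` factors
  through a projective `A`-module ⇒ `(algebraMap c)²` kills `Ext^{≥ 2}_{A[X]}(M, −)`).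
  (All of §2 is stated over the abstract `R = A[x]`; read `A[X]` for `R`.)
* §3 `relativeSequence_shortExact_polynomial`, `sq_smul_ext_eq_zero_polynomial`,
  `sq_smul_ext_eq_zero_polynomial_of_forall_ge`, `sq_smul_ext_eq_zero_polynomial_of_comp_eq_smul_id` —
  the same for `R = Polynomial A` literally (`basisMonomials_eq_pow`).

What is NOT here (FILE 2 of the cut, sized separately): THEOREM A (i)(ii) itself — the secondary map
`ω*` built from a null-homotopy of `c` on the `A`-syzygies and the EXACT criterion
`c · Extᵐ_R(M,N) = 0 ⟺ ω*(K_m) ⊆ (u₂ − u₁)E_{m−1}` — and the Sylvester criterion (3.1). The retract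
route to exponent two (`A[u] → A`, `…PersistenceRetractEngine`, p501952) is a different theorem
(about `ca(A)` from `ca(A[u])`-type data) and is not redone here.
-/

-- single-problem summit: the doubled namespace component is forced
set_option linter.dupNamespace false

noncomputable section

open CategoryTheory CategoryTheory.Abelian Polynomial
open scoped TensorProduct

universe u

namespace Summit.ResolutionOfSingularities.ResolutionOfSingularities.Theorems.HomologicalConductor.PersistenceRelativeSequence

open Literature.RingTheory.CohomologyAnnihilator
open Summit.ResolutionOfSingularities.ResolutionOfSingularities.Theorems.HomologicalConductor.PersistenceTwoStepTransferExponentTwo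
open Summit.ResolutionOfSingularities.ResolutionOfSingularities.Theorems.HomologicalConductor.PersistenceExtFlatBaseChange

/-! ## §1 The relative sequence (THEOREM-A (1.1)) -/

section Core

variable {A R : Type u} [CommRing A] [CommRing R] [Algebra A R] (x : R) (b : Module.Basis ℕ A R)
  (hb : ∀ n : ℕ, b n = x ^ n) {M : Type u} [AddCommGroup M] [Module A M] [Module R M]
  [IsScalarTower A R M]

/-- **The two maps of the relative sequence exist** (THEOREM-A (1.1)): on `R ⊗_A M` there are
`R`-linear maps `T = X ⊗ 1 − 1 ⊗ X_M` and `μ = ` multiplication, i.e. `T (p ⊗ m) = Xp ⊗ m − p ⊗ Xm`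
and `μ (p ⊗ m) = p • m` (realised as `X • id − (X_M).baseChange` and `id.liftBaseChange`). All later
statements take `T`, `μ` as ANY maps with these values on pure tensors (which determine them).
[folklore] -/
theorem exists_relativeMaps :
    ∃ (T : R ⊗[A] M →ₗ[R] R ⊗[A] M) (μ : R ⊗[A] M →ₗ[R] M),
      (∀ (p : R) (m : M), T (p ⊗ₜ[A] m) = (x * p) ⊗ₜ[A] m - p ⊗ₜ[A] (x • m)) ∧
      (∀ (p : R) (m : M), μ (p ⊗ₜ[A] m) = p • m) := by
  refine ⟨x • LinearMap.id -
      ((LinearMap.lsmul R M x).restrictScalars A).baseChange R,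
    (LinearMap.id : M →ₗ[A] M).liftBaseChange R, fun p m => ?_, fun p m => ?_⟩
  · simp [TensorProduct.smul_tmul']
  · simp [LinearMap.liftBaseChange_tmul]

variable (T : R ⊗[A] M →ₗ[R] R ⊗[A] M) (μ : R ⊗[A] M →ₗ[R] M)
  (hT : ∀ (p : R) (m : M), T (p ⊗ₜ[A] m) = (x * p) ⊗ₜ[A] m - p ⊗ₜ[A] (x • m))
  (hμ : ∀ (p : R) (m : M), μ (p ⊗ₜ[A] m) = p • m)
include hT hμ

/-- `μ ∘ T = 0` (THEOREM-A (1.1): «`μT = 0`»). [folklore] -/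
theorem mu_comp_T : μ.restrictScalars A ∘ₗ T.restrictScalars A = 0 := by
  refine TensorProduct.ext' fun p m => ?_
  simp only [LinearMap.comp_apply, LinearMap.restrictScalars_apply, LinearMap.zero_apply]
  rw [hT, map_sub, hμ, hμ, mul_smul, smul_comm p x m, sub_self]

omit [IsScalarTower A R M] hT in
/-- `μ` is onto (`μ (1 ⊗ m) = m`). [folklore] -/
theorem mu_surjective : Function.Surjective μ := fun m => ⟨1 ⊗ₜ m, by simp [hμ]⟩

include hb

/-- **The `A`-linear splitting** («division by `X ⊗ 1 − 1 ⊗ X`»): there is an `A`-linear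
`G : R ⊗_A M → R ⊗_A M`, `G (Xⁿ ⊗ m) = Σ_{j<n} Xʲ ⊗ X^{n−1−j} m`, with `G ∘ T = id` and
`T ∘ G = id − (1 ⊗ −) ∘ μ`. This replaces THEOREM-A's «looking at the top term / descending induction
on the top degree» by two telescoping sums. [folklore] -/
theorem exists_splitting :
    ∃ G : R ⊗[A] M →ₗ[A] R ⊗[A] M,
      G ∘ₗ T.restrictScalars A = LinearMap.id ∧
      T.restrictScalars A ∘ₗ G =
        LinearMap.id - TensorProduct.mk A R M 1 ∘ₗ μ.restrictScalars A := by
  classical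
  -- the pieces `L n : M →ₗ[A] R ⊗ M`, `L n m = Σ_{j<n} Xʲ ⊗ X^{n-1-j} • m`
  let L : ℕ → (M →ₗ[A] R ⊗[A] M) := fun n =>
    ∑ j ∈ Finset.range n,
      TensorProduct.mk A R M (x ^ j) ∘ₗ
        (LinearMap.lsmul R M (x ^ (n - 1 - j))).restrictScalars A
  have hL : ∀ (n : ℕ) (m : M),
      L n m = ∑ j ∈ Finset.range n, (x ^ j) ⊗ₜ[A] (x ^ (n - 1 - j) • m) := by
    intro n m
    simp [L]
  let G : R ⊗[A] M →ₗ[A] R ⊗[A] M :=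
    TensorProduct.lift ((b).constr A L)
  have hG : ∀ (n : ℕ) (m : M), G ((x ^ n) ⊗ₜ[A] m) =
      ∑ j ∈ Finset.range n, (x ^ j) ⊗ₜ[A] (x ^ (n - 1 - j) • m) := by
    intro n m
    rw [← hL, ← hb]
    change TensorProduct.lift ((b).constr A L) _ = _
    rw [TensorProduct.lift.tmul, (b).constr_basis]
  -- two linear maps out of `R ⊗[A] M` agree once they agree on `Xⁿ ⊗ m`
  have hext : ∀ {f g : R ⊗[A] M →ₗ[A] R ⊗[A] M},
      (∀ (n : ℕ) (m : M), f ((x ^ n) ⊗ₜ[A] m) = g ((x ^ n) ⊗ₜ[A] m)) → f = g := by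
    intro f g h
    refine TensorProduct.ext ?_
    refine (b).ext fun n => LinearMap.ext fun m => ?_
    simpa [hb] using h n m
  refine ⟨G, hext fun n m => ?_, hext fun n m => ?_⟩
  · -- `G (T (Xⁿ ⊗ m)) = L (n+1) m - L n (X m) = Xⁿ ⊗ m`
    rw [LinearMap.comp_apply, LinearMap.restrictScalars_apply, hT, ← pow_succ', map_sub, hG, hG,
      Finset.sum_range_succ, LinearMap.id_apply]
    have : ∑ j ∈ Finset.range n, (x ^ j) ⊗ₜ[A] (x ^ (n + 1 - 1 - j) • m) =
        ∑ j ∈ Finset.range n, (x ^ j) ⊗ₜ[A] (x ^ (n - 1 - j) • x • m) := by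
      refine Finset.sum_congr rfl fun j hj => ?_
      rw [Finset.mem_range] at hj
      rw [← mul_smul, ← pow_succ, show n - 1 - j + 1 = n + 1 - 1 - j by omega]
    rw [this, add_sub_cancel_left, show n + 1 - 1 - n = 0 by omega, pow_zero, one_smul]
  · -- `T (G (Xⁿ ⊗ m)) = Σ_{j<n} (X^{j+1} ⊗ X^{n-1-j} m - Xʲ ⊗ X^{n-j} m) = Xⁿ ⊗ m - 1 ⊗ Xⁿ m`
    rw [LinearMap.comp_apply, hG, map_sum, LinearMap.sub_apply, LinearMap.id_apply,
      LinearMap.comp_apply, LinearMap.restrictScalars_apply, hμ, TensorProduct.mk_apply]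
    have hterm : ∀ j ∈ Finset.range n,
        T.restrictScalars A ((x ^ j) ⊗ₜ[A] (x ^ (n - 1 - j) • m)) =
          (x ^ (j + 1)) ⊗ₜ[A] (x ^ (n - (j + 1)) • m) -
            (x ^ j) ⊗ₜ[A] (x ^ (n - j) • m) := by
      intro j hj
      rw [Finset.mem_range] at hj
      rw [LinearMap.restrictScalars_apply, hT, ← pow_succ', ← mul_smul, ← pow_succ',
        show n - 1 - j + 1 = n - j by omega, show n - (j + 1) = n - 1 - j by omega]
    rw [Finset.sum_congr rfl hterm,
      Finset.sum_range_sub (fun j => (x ^ j) ⊗ₜ[A] (x ^ (n - j) • m)) n]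
    simp

/-- `T` is injective: `ker T = ⊥` (it has the `A`-linear retraction `G`). [folklore] -/
theorem ker_T_eq_bot : LinearMap.ker T = ⊥ := by
  obtain ⟨G, hGT, -⟩ := exists_splitting x b hb T μ hT hμ
  refine LinearMap.ker_eq_bot.mpr fun x y hxy => ?_
  have := LinearMap.congr_fun hGT x
  have := LinearMap.congr_fun hGT y
  simp only [LinearMap.comp_apply, LinearMap.restrictScalars_apply, LinearMap.id_apply] at *
  rw [← ‹G (T x) = x›, ← ‹G (T y) = y›, hxy]

/-- Exactness in the middle: `ker μ = range T` (from `T ∘ G = id − (1 ⊗ −) ∘ μ`). [folklore] -/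
theorem exact_T_mu : Function.Exact T μ := by
  obtain ⟨G, -, hTG⟩ := exists_splitting x b hb T μ hT hμ
  refine Function.Exact.of_comp_of_mem_range ?_ fun z hz => ?_
  · ext z
    simpa using LinearMap.congr_fun (mu_comp_T x T μ hT hμ) z
  · refine ⟨G z, ?_⟩
    have h := LinearMap.congr_fun hTG z
    simp only [LinearMap.comp_apply, LinearMap.restrictScalars_apply, LinearMap.sub_apply,
      LinearMap.id_apply, TensorProduct.mk_apply] at h
    rw [h, show μ z = 0 from hz, TensorProduct.tmul_zero, sub_zero]

/-- **THE RELATIVE SEQUENCE IS SHORT EXACT** in `ModuleCat R` (THEOREM-A (1.1)):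
`0 → R ⊗_A M —T→ R ⊗_A M —μ→ M → 0`, for ANY commutative `A` and ANY `R`-module `M`
(no finiteness over `A` or `R`). [folklore] -/
theorem relativeSequence_shortExact :
    ∃ w : ModuleCat.ofHom (X := R ⊗[A] M) (Y := R ⊗[A] M) T ≫
        ModuleCat.ofHom (X := R ⊗[A] M) (Y := M) μ = 0,
      (ShortComplex.mk (ModuleCat.ofHom (X := R ⊗[A] M) (Y := R ⊗[A] M) T)
        (ModuleCat.ofHom (X := R ⊗[A] M) (Y := M) μ) w).ShortExact :=
  exists_shortExact_of_linearMap (Y := ModuleCat.of R (R ⊗[A] M))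
    (M := ModuleCat.of R (R ⊗[A] M)) (X := ModuleCat.of R M) T μ
    (LinearMap.ker_eq_bot.mp (ker_T_eq_bot x b hb T μ hT hμ)) (mu_surjective μ hμ) (exact_T_mu x b hb T μ hT hμ)

end Core

/-! ## §2 Exponent two (THEOREM-A Cor. (3.2)) -/

section ExponentTwo

variable {A R : Type u} [CommRing A] [CommRing R] [Algebra A R] (x : R) (b : Module.Basis ℕ A R)
  (hb : ∀ n : ℕ, b n = x ^ n) {M : Type u} [AddCommGroup M] [Module A M] [Module R M]
  [IsScalarTower A R M]
include hb

/-- **Exponent two, `R`-currency** (the long exact `Ext` sequence of the relative sequence): if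
`c` kills `Extᵐ_R(R ⊗_A M, N)` and `d` kills `Ext^{m+1}_R(R ⊗_A M, N)` then `c * d` kills
`Ext^{m+1}_R(M, N)` — `μ^*(d • e) = 0` puts `d • e` in the image of the connecting map from
`Extᵐ(R ⊗_A M, N)`, which `c` kills. [folklore] -/
theorem mul_smul_ext_eq_zero_of_relativeSequence {N : ModuleCat.{u} R} {m : ℕ} {c d : R}
    (hc : ∀ e : Ext.{u} (ModuleCat.of R (R ⊗[A] M)) N m, c • e = 0)
    (hd : ∀ e : Ext.{u} (ModuleCat.of R (R ⊗[A] M)) N (m + 1), d • e = 0)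
    (e : Ext.{u} (ModuleCat.of R M) N (m + 1)) : (c * d) • e = 0 := by
  obtain ⟨T, μ, hT, hμ⟩ := exists_relativeMaps (A := A) x (M := M)
  obtain ⟨w, hS⟩ := relativeSequence_shortExact x b hb T μ hT hμ
  have h1 : (1 : ℕ) + m = m + 1 := by omega
  have key := mul_smul_ext_X₃_eq_zero_of_shortExact hS h1 (N := N) (c := c) (d := d)
  exact key hd hc e

/-- **Exponent two, `A`-currency** (THEOREM-A Cor. (3.2) with `E_m = Extᵐ_A(M|_A, N|_A)`): if
`c : A` kills `Extᵐ_A(M|_A, N|_A)` and `Ext^{m+1}_A(M|_A, N|_A)` — here `M|_A = ModuleCat.of A M`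
and `N|_A = restrictScalars (algebraMap A R) N` — then `(algebraMap A R c)²` kills
`Ext^{m+1}_R(M, N)`. Hypotheses on the PAIR `(c, M|_A)`; `M|_A` need not be finitely generated.
(`R = A[x]` is flat over `A`, being free on the powers of `x`.) [folklore] -/
theorem sq_smul_ext_eq_zero_of_restrictScalars {N : ModuleCat.{u} R} {m : ℕ} {c : A}
    (hc₀ : ∀ e : Ext.{u} (ModuleCat.of A M)
      ((ModuleCat.restrictScalars.{u, u, u} (algebraMap A R)).obj N) m, c • e = 0)
    (hc₁ : ∀ e : Ext.{u} (ModuleCat.of A M)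
      ((ModuleCat.restrictScalars.{u, u, u} (algebraMap A R)).obj N) (m + 1), c • e = 0)
    (e : Ext.{u} (ModuleCat.of R M) N (m + 1)) :
    (algebraMap A R c * algebraMap A R c) • e = 0 := by
  haveI : Module.Free A R := Module.Free.of_basis b
  exact mul_smul_ext_eq_zero_of_relativeSequence x b hb (smul_ext_eq_zero_of_flat hc₀)
    (smul_ext_eq_zero_of_flat hc₁) e

/-- The same with coefficients `N` given as a type carrying compatible `A`- and `R`-structures.
[folklore] -/
theorem sq_smul_ext_eq_zero_of_isScalarTower {N : Type u} [AddCommGroup N] [Module A N]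
    [Module R N] [IsScalarTower A R N] {m : ℕ} {c : A}
    (hc₀ : ∀ e : Ext.{u} (ModuleCat.of A M) (ModuleCat.of A N) m, c • e = 0)
    (hc₁ : ∀ e : Ext.{u} (ModuleCat.of A M) (ModuleCat.of A N) (m + 1), c • e = 0)
    (e : Ext.{u} (ModuleCat.of R M) (ModuleCat.of R N) (m + 1)) :
    (algebraMap A R c * algebraMap A R c) • e = 0 := by
  haveI : Module.Free A R := Module.Free.of_basis b
  exact mul_smul_ext_eq_zero_of_relativeSequence x b hb (smul_ext_eq_zero_of_flat' hc₀)
    (smul_ext_eq_zero_of_flat' hc₁) e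

/-- **THEOREM-A's (Hₙ) in `Ext`-currency ⇒ exponent two from degree `n + 1` on**: if `c : A` kills
`Extⁱ_A(M|_A, L)` for every `A`-module `L` and every `i ≥ n` (which is what «`c · 1_{Ω_{n−1}}`
factors through a projective» gives), then `(algebraMap A R c)²` kills `Extᵐ_R(M, N)` for every
`R`-module `N` and every `m ≥ n + 1`. [folklore] -/
theorem sq_smul_ext_eq_zero_of_forall_ge {n : ℕ} {c : A}
    (hc : ∀ (L : ModuleCat.{u} A) (i : ℕ), n ≤ i → ∀ e : Ext.{u} (ModuleCat.of A M) L i, c • e = 0)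
    (N : ModuleCat.{u} R) {m : ℕ} (hm : n + 1 ≤ m) (e : Ext.{u} (ModuleCat.of R M) N m) :
    (algebraMap A R c * algebraMap A R c) • e = 0 := by
  obtain ⟨m, rfl⟩ : ∃ m', m = m' + 1 := ⟨m - 1, by omega⟩
  exact sq_smul_ext_eq_zero_of_restrictScalars x b hb (hc _ m (by omega)) (hc _ (m + 1) (by omega)) e

/-- **THEOREM-A with (H₁) literally** (stable-annihilation currency, `n = 1`): if `c • 𝟙_{M|_A}`
factors through a projective `A`-module (`ι ≫ π = c • 𝟙`), then `(algebraMap A R c)²` kills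
`Extᵐ_R(M, N)` for every `R`-module `N` and every `m ≥ 2` — the case of THEOREM-A Cor. (3.2)
that needs no syzygies to state. [folklore] -/
theorem sq_smul_ext_eq_zero_of_comp_eq_smul_id {c : A} {P : ModuleCat.{u} A} [Projective P]
    (ι : ModuleCat.of A M ⟶ P) (π : P ⟶ ModuleCat.of A M) (h : ι ≫ π = c • 𝟙 (ModuleCat.of A M))
    (N : ModuleCat.{u} R) {m : ℕ} (hm : 2 ≤ m) (e : Ext.{u} (ModuleCat.of R M) N m) :
    (algebraMap A R c * algebraMap A R c) • e = 0 :=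
  sq_smul_ext_eq_zero_of_forall_ge x b hb (n := 1)
    (fun _ _ hi e' => smul_ext_eq_zero_of_comp_eq_smul_id ι π h hi e') N hm e

end ExponentTwo


/-! ## §3 The polynomial ring `A[X]` literally -/

section PolynomialRing

variable {A : Type u} [CommRing A] {M : Type u} [AddCommGroup M] [Module A M] [Module A[X] M]
  [IsScalarTower A A[X] M]

/-- The monomial basis of `A[X]` is the basis of powers of `X`. [folklore] -/
theorem basisMonomials_eq_pow (n : ℕ) : Polynomial.basisMonomials A n = (X : A[X]) ^ n := by
  simp [Polynomial.coe_basisMonomials, Polynomial.X_pow_eq_monomial]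

/-- **The relative sequence for `R = A[X]` literally** (THEOREM-A (1.1)):
`0 → A[X] ⊗_A M —T→ A[X] ⊗_A M —μ→ M → 0` is short exact in `ModuleCat A[X]` for ANY `A[X]`-module
`M`, where `T (p ⊗ m) = Xp ⊗ m − p ⊗ Xm`, `μ (p ⊗ m) = p • m`. [folklore] -/
theorem relativeSequence_shortExact_polynomial
    (T : A[X] ⊗[A] M →ₗ[A[X]] A[X] ⊗[A] M) (μ : A[X] ⊗[A] M →ₗ[A[X]] M)
    (hT : ∀ (p : A[X]) (m : M), T (p ⊗ₜ[A] m) = (X * p) ⊗ₜ[A] m - p ⊗ₜ[A] ((X : A[X]) • m))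
    (hμ : ∀ (p : A[X]) (m : M), μ (p ⊗ₜ[A] m) = p • m) :
    ∃ w : ModuleCat.ofHom (X := A[X] ⊗[A] M) (Y := A[X] ⊗[A] M) T ≫
        ModuleCat.ofHom (X := A[X] ⊗[A] M) (Y := M) μ = 0,
      (ShortComplex.mk (ModuleCat.ofHom (X := A[X] ⊗[A] M) (Y := A[X] ⊗[A] M) T)
        (ModuleCat.ofHom (X := A[X] ⊗[A] M) (Y := M) μ) w).ShortExact :=
  relativeSequence_shortExact (X : A[X]) (Polynomial.basisMonomials A) basisMonomials_eq_pow T μ hT hμ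

/-- **THEOREM-A Cor. (3.2) for `R = A[X]`, `A`-currency**: if `c : A` kills `Extᵐ_A(M|_A, N|_A)`
and `Ext^{m+1}_A(M|_A, N|_A)` (`N|_A = restrictScalars (algebraMap A A[X]) N`), then
`(algebraMap A A[X] c)²` kills `Ext^{m+1}_{A[X]}(M, N)`; `M` is ANY `A[X]`-module. [folklore] -/
theorem sq_smul_ext_eq_zero_polynomial {N : ModuleCat.{u} A[X]} {m : ℕ} {c : A}
    (hc₀ : ∀ e : Ext.{u} (ModuleCat.of A M)
      ((ModuleCat.restrictScalars.{u, u, u} (algebraMap A A[X])).obj N) m, c • e = 0)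
    (hc₁ : ∀ e : Ext.{u} (ModuleCat.of A M)
      ((ModuleCat.restrictScalars.{u, u, u} (algebraMap A A[X])).obj N) (m + 1), c • e = 0)
    (e : Ext.{u} (ModuleCat.of A[X] M) N (m + 1)) :
    (algebraMap A A[X] c * algebraMap A A[X] c) • e = 0 :=
  sq_smul_ext_eq_zero_of_restrictScalars (X : A[X]) (Polynomial.basisMonomials A)
    basisMonomials_eq_pow hc₀ hc₁ e

/-- **THEOREM-A's (Hₙ) ⇒ exponent two, for `R = A[X]`**: `c : A` kills `Ext^{≥ n}_A(M|_A, −)` ⇒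
`(algebraMap A A[X] c)²` kills `Ext^{≥ n+1}_{A[X]}(M, −)`. [folklore] -/
theorem sq_smul_ext_eq_zero_polynomial_of_forall_ge {n : ℕ} {c : A}
    (hc : ∀ (L : ModuleCat.{u} A) (i : ℕ), n ≤ i → ∀ e : Ext.{u} (ModuleCat.of A M) L i, c • e = 0)
    (N : ModuleCat.{u} A[X]) {m : ℕ} (hm : n + 1 ≤ m) (e : Ext.{u} (ModuleCat.of A[X] M) N m) :
    (algebraMap A A[X] c * algebraMap A A[X] c) • e = 0 :=
  sq_smul_ext_eq_zero_of_forall_ge (X : A[X]) (Polynomial.basisMonomials A) basisMonomials_eq_pow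
    hc N hm e

/-- **THEOREM-A with (H₁), for `R = A[X]`**: `c • 𝟙_{M|_A}` factors through a projective
`A`-module ⇒ `(algebraMap A A[X] c)²` kills `Ext^{≥ 2}_{A[X]}(M, −)`. [folklore] -/
theorem sq_smul_ext_eq_zero_polynomial_of_comp_eq_smul_id {c : A} {P : ModuleCat.{u} A}
    [Projective P] (ι : ModuleCat.of A M ⟶ P) (π : P ⟶ ModuleCat.of A M)
    (h : ι ≫ π = c • 𝟙 (ModuleCat.of A M)) (N : ModuleCat.{u} A[X]) {m : ℕ} (hm : 2 ≤ m)
    (e : Ext.{u} (ModuleCat.of A[X] M) N m) :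
    (algebraMap A A[X] c * algebraMap A A[X] c) • e = 0 :=
  sq_smul_ext_eq_zero_of_comp_eq_smul_id (X : A[X]) (Polynomial.basisMonomials A)
    basisMonomials_eq_pow ι π h N hm e

end PolynomialRing

end Summit.ResolutionOfSingularities.ResolutionOfSingularities.Theorems.HomologicalConductor.PersistenceRelativeSequence
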